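import Summits.Ventures.Crystal3D.LocalLP.Saturation
import Summits.Ventures.Crystal3D.LocalLP.H2Instance
import Summits.Ventures.Crystal3D.StickySpheres.RadiusOne
import Literature.Geometry.DiscreteGeometry.HalesTwelveNeighbourGap
import Mathlib.Analysis.InnerProductSpace.Basic
import HarnessLib

/-!
# Kissing saturation below the twelve-neighbour gap: `SaturationInput r` from Flyspeck's `L12`

HONEST FRAMING. Part of the venture `Summits/Ventures/Crystal3D` (cell `pub-crystal3d`). This file
reduces the named input `(K)` of `LocalLP/SurfaceComposition.lean` at probing radii
`2/2.52 < r ≤ 1` (diameter-`1` units; this covers H2's `r = 1783/2000`) to the tree's named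
Flyspeck inequality `Literature.Geometry.DiscreteGeometry.flyspeck_L12` (Hales 2012, verified in
HOL Light; NOT proved in this tree), through the tree's PROVED consequence
`hales_twelveNeighbourGap_of_L12` (the `2.52` twelve-neighbour gap, Bezdek–Reid Thm 5).
Argument: if ball `i` has twelve contacts and an exposed direction `u` at radius `r`, then for
every contact direction `e` exposedness gives `⟪u, e⟫ ≤ 1/(2r)`, so the point `x i + r⁻¹ u` is at
distance `≥ 1` from all twelve neighbours and at distance `r⁻¹ < 1.26` from `x i`: a fourteenth
ball closer than the gap allows. Hence `exposedCap x r i = ∅` and the exposed fraction is `0`.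
Result: `saturationInput_of_L12 : flyspeck_L12 → 2/2.52 < r → r ≤ 1 → SaturationInput r`, and
the corollary `H2_surfaceBound_of_L12 : flyspeck_L12 → LevyCapInput rH2 FH2 → IsoInput rH2 sH2 →
(∀ N ≥ 2, ∀ packing, C < 6N - (79/25) N^{2/3})`, so H2's trust base becomes
{(L), (I), `flyspeck_L12`}. No crystallization statement is claimed.
-/

noncomputable section

open scoped BigOperators RealInnerProductSpace
open Finset

namespace Summit.Ventures.Crystal3D

open Literature.Geometry.DiscreteGeometry (flyspeck_L12 hales_twelveNeighbourGap_of_L12)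

variable {N : ℕ} {x : Fin N → EuclideanSpace ℝ (Fin 3)}

/-- The elementary step: if `‖u‖ = ‖e‖ = 1`, `0 < r` and `‖r • u - e‖ ≥ r` (the point `r u` is
not closer than `r` to `e`), then `‖r⁻¹ • u - e‖ ≥ 1`. -/
theorem one_le_norm_inv_smul_sub {u e : EuclideanSpace ℝ (Fin 3)} (hu : ‖u‖ = 1) (he : ‖e‖ = 1)
    {r : ℝ} (hr : 0 < r) (h : r ≤ ‖r • u - e‖) : 1 ≤ ‖r⁻¹ • u - e‖ := by
  have h1 : r ^ 2 ≤ ‖r • u - e‖ ^ 2 := pow_le_pow_left₀ hr.le h 2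
  rw [norm_sub_sq_real, norm_smul, Real.norm_eq_abs, abs_of_pos hr, hu, he, inner_smul_left]
    at h1
  simp only [mul_one, one_pow, RCLike.conj_to_real] at h1
  -- `2 r ⟪u, e⟫ ≤ 1`
  have h2 : 2 * r * ⟪u, e⟫ ≤ 1 := by nlinarith
  have h3 : 1 ≤ ‖r⁻¹ • u - e‖ ^ 2 := by
    rw [norm_sub_sq_real, norm_smul, Real.norm_eq_abs, abs_of_pos (inv_pos.2 hr), hu, he,
      inner_smul_left]
    simp only [mul_one, one_pow, RCLike.conj_to_real]
    have hr' : r⁻¹ * (2 * r * ⟪u, e⟫) ≤ r⁻¹ * 1 :=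
      mul_le_mul_of_nonneg_left h2 (inv_pos.2 hr).le
    have hrr : r⁻¹ * (2 * r * ⟪u, e⟫) = 2 * ⟪u, e⟫ := by field_simp
    rw [hrr] at hr'
    nlinarith [sq_nonneg r⁻¹, inv_pos.2 hr]
  exact (one_le_sq_iff₀ (norm_nonneg _)).1 h3

/-- A fourteen-ball configuration from a centre, twelve neighbours and one more point:
packaging for `hales_twelveNeighbourGap_of_L12`. -/
theorem fourteen_of_twelve {p₀ q : EuclideanSpace ℝ (Fin 3)} {nb : Fin 12 → EuclideanSpace ℝ (Fin 3)}
    (h0n : ∀ a, dist (nb a) p₀ = 2) (hnn : ∀ a b, a ≠ b → 2 ≤ dist (nb a) (nb b))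
    (h0q : 2 ≤ dist p₀ q) (hnq : ∀ a, 2 ≤ dist (nb a) q) :
    ∃ c : Fin 14 → EuclideanSpace ℝ (Fin 3),
      (∀ k l : Fin 14, k ≠ l → (2 : ℝ) ≤ dist (c k) (c l)) ∧
      (∀ k : Fin 14, k ≠ 0 → k ≠ 13 → dist (c k) (c 0) = 2) ∧ c 0 = p₀ ∧ c 13 = q := by
  set c : Fin 14 → EuclideanSpace ℝ (Fin 3) := Fin.cons p₀ (Fin.snoc nb q) with hc
  have c0 : c 0 = p₀ := by simp [hc]
  have c13 : c 13 = q := by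
    have : (13 : Fin 14) = Fin.succ (Fin.last 12) := rfl
    rw [this, hc, Fin.cons_succ, Fin.snoc_last]
  have cmid : ∀ a : Fin 12, c (Fin.succ (Fin.castSucc a)) = nb a := fun a => by
    rw [hc, Fin.cons_succ, Fin.snoc_castSucc]
  -- ordered pairs first
  have key : ∀ k l : Fin 14, k < l → (2 : ℝ) ≤ dist (c k) (c l) := by
    intro k l hkl
    rcases Fin.eq_zero_or_eq_succ l with rfl | ⟨l', rfl⟩
    · exact absurd hkl (Fin.not_lt_zero k)
    rcases Fin.eq_zero_or_eq_succ k with rfl | ⟨k', rfl⟩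
    · rcases Fin.eq_castSucc_or_eq_last l' with ⟨b, rfl⟩ | rfl
      · rw [c0, cmid, dist_comm, h0n]
      · rw [c0, show Fin.succ (Fin.last 12) = (13 : Fin 14) from rfl, c13]; exact h0q
    · have hkl' : k' < l' := Fin.succ_lt_succ_iff.1 hkl
      rcases Fin.eq_castSucc_or_eq_last l' with ⟨b, rfl⟩ | rfl
      · rcases Fin.eq_castSucc_or_eq_last k' with ⟨a, rfl⟩ | rfl
        · rw [cmid, cmid]
          exact hnn a b fun h => (ne_of_lt hkl') (by rw [h])
        · exact absurd hkl' (not_lt.2 (Fin.le_last _))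
      · rcases Fin.eq_castSucc_or_eq_last k' with ⟨a, rfl⟩ | rfl
        · rw [cmid, show Fin.succ (Fin.last 12) = (13 : Fin 14) from rfl, c13]; exact hnq a
        · exact absurd hkl' (lt_irrefl _)
  refine ⟨c, ?_, ?_, c0, c13⟩
  · intro k l hkl
    rcases lt_or_gt_of_ne hkl with h | h
    · exact key k l h
    · rw [dist_comm]; exact key l k h
  · intro k hk0 hk13
    rcases Fin.eq_zero_or_eq_succ k with rfl | ⟨k', rfl⟩
    · exact absurd rfl hk0
    rcases Fin.eq_castSucc_or_eq_last k' with ⟨a, rfl⟩ | rfl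
    · rw [cmid, c0, h0n]
    · exact absurd rfl hk13

/-- **No exposed direction below the gap.** Under `flyspeck_L12`: in a packing of diameter-`1`
balls, a ball with twelve contacts has no exposed direction at any probing radius
`2/2.52 < r ≤ 1`. -/
theorem exposedCap_eq_empty_of_L12 (hL12 : flyspeck_L12) {r : ℝ} (hr : 2 / 2.52 < r)
    (hr1 : r ≤ 1) (hx : IsUnitPacking x) (i : Fin N) (h12 : coordination x i = 12) :
    exposedCap x r i = ∅ := by
  classical
  have hr0 : 0 < r := lt_trans (by norm_num) hr
  ext u
  simp only [exposedCap, Set.mem_setOf_eq, Set.mem_empty_iff_false, iff_false, not_and]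
  intro hu hfar
  -- enumerate the twelve neighbours
  have hcard : (contactNeighbors x i).card = 12 := h12
  set nbI : Fin 12 ↪o Fin N := (contactNeighbors x i).orderEmbOfFin hcard with hnbI
  have hmem : ∀ a, nbI a ∈ contactNeighbors x i := fun a =>
    (contactNeighbors x i).orderEmbOfFin_mem hcard a
  -- radius-1 picture: centre `2 x i`, neighbours `2 x (nbI a)`, new point `2 (x i + r⁻¹ u)`
  set q : EuclideanSpace ℝ (Fin 3) := x i + r⁻¹ • u with hq
  obtain ⟨c, hpack, htouch, hc0, hc13⟩ := fourteen_of_twelve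
    (p₀ := (2 : ℝ) • x i) (q := (2 : ℝ) • q) (nb := fun a => (2 : ℝ) • x (nbI a))
    (fun a => by rw [dist_two_smul, dist_comm, ((mem_contactNeighbors x).1 (hmem a)).2]; norm_num)
    (fun a b hab => by
      rw [dist_two_smul]
      have : nbI a ≠ nbI b := fun h => hab (nbI.injective h)
      linarith [hx this])
    (by
      rw [dist_two_smul, hq, dist_eq_norm, sub_add_cancel_left, norm_neg, norm_smul,
        Real.norm_eq_abs, abs_of_pos (inv_pos.2 hr0), hu, mul_one]
      have : 1 ≤ r⁻¹ := one_le_inv_iff₀.2 ⟨hr0, hr1⟩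
      linarith)
    (fun a => by
      rw [dist_two_smul, dist_comm, hq, dist_eq_norm]
      have hji : nbI a ≠ i := ((mem_contactNeighbors x).1 (hmem a)).1
      have hcontact : dist (x i) (x (nbI a)) = 1 := ((mem_contactNeighbors x).1 (hmem a)).2
      -- `e = x (nbI a) - x i` is a unit vector with `‖r u - e‖ ≥ r`
      have he : ‖x (nbI a) - x i‖ = 1 := by rw [← dist_eq_norm, dist_comm]; exact hcontact
      have hfar' : r ≤ ‖r • u - (x (nbI a) - x i)‖ := by
        have h := hfar (nbI a) hji
        rw [dist_eq_norm] at h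
        have : x i + r • u - x (nbI a) = r • u - (x (nbI a) - x i) := by abel
        rwa [this] at h
      have h1 := one_le_norm_inv_smul_sub hu he hr0 hfar'
      have : x i + r⁻¹ • u - x (nbI a) = r⁻¹ • u - (x (nbI a) - x i) := by abel
      rw [this]
      linarith)
  have hgap := hales_twelveNeighbourGap_of_L12 hL12 c hpack htouch
  rw [hc0, hc13, dist_two_smul, hq, dist_eq_norm] at hgap
  have hnorm : ‖x i - (x i + r⁻¹ • u)‖ = r⁻¹ := by
    rw [sub_add_cancel_left, norm_neg, norm_smul, Real.norm_eq_abs, abs_of_pos (inv_pos.2 hr0),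
      hu, mul_one]
  rw [hnorm] at hgap
  -- `2.52 ≤ 2 / r` contradicts `2 / 2.52 < r`
  have h1 : (2.52 : ℝ) * r ≤ 2 := by
    have := mul_le_mul_of_nonneg_right hgap hr0.le
    rwa [mul_assoc, inv_mul_cancel₀ hr0.ne', mul_one] at this
  have h2 : (2 : ℝ) < 2.52 * r := by
    have := mul_lt_mul_of_pos_left hr (by norm_num : (0 : ℝ) < 2.52)
    rwa [mul_div_cancel₀ _ (by norm_num : (2.52 : ℝ) ≠ 0)] at this
  linarith

/-- **`(K)` below the gap, from `L12`.** Under Flyspeck's `L12`, kissing saturation holds at every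
probing radius `2/2.52 < r ≤ 1` (diameter-`1` units): a ball with twelve contacts has exposed
fraction `0`. In particular at H2's `r = 1783/2000`. -/
theorem saturationInput_of_L12 (hL12 : flyspeck_L12) {r : ℝ} (hr : 2 / 2.52 < r) (hr1 : r ≤ 1) :
    SaturationInput r := by
  intro N x hx i h12
  unfold exposedFraction
  rw [exposedCap_eq_empty_of_L12 hL12 hr hr1 hx i h12]
  exact ballFraction_rayCone_empty

/-- H2's probing radius `rH2 = 1783/2000` lies in the gap range. -/
theorem saturationInput_H2_of_L12 (hL12 : flyspeck_L12) : SaturationInput rH2 :=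
  saturationInput_of_L12 hL12 (by norm_num [rH2]) (by norm_num [rH2])

/-- **H2 with `(K)` discharged by `L12`**: under Flyspeck's `L12`, the cap input `(L)` with
engine-2's table and the isoperimetric input `(I)` at `rH2` give `C(x) < 6N - (79/25) N^{2/3}`
for every packing of `N ≥ 2` diameter-`1` balls. Trust base: {(L), (I), `flyspeck_L12`}. -/
theorem H2_surfaceBound_of_L12 (hL12 : flyspeck_L12) (hL : LevyCapInput rH2 FH2)
    (hI : IsoInput rH2 sH2) :
    ∀ N : ℕ, 2 ≤ N → ∀ x : Fin N → EuclideanSpace ℝ (Fin 3), IsUnitPacking x →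
      (numContacts x : ℝ) < 6 * N - (79 / 25 : ℝ) * (N : ℝ) ^ ((2 : ℝ) / 3) :=
  H2_surfaceBound hL (saturationInput_H2_of_L12 hL12) hI

end Summit.Ventures.Crystal3D

end
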